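import Mathlib.Algebra.Ring.GeomSum
import Mathlib.Analysis.Calculus.Deriv.Pow
import Mathlib.Analysis.Calculus.Deriv.Add
import Mathlib.Analysis.Calculus.Deriv.Mul
import Mathlib.LinearAlgebra.CliffordAlgebra.Conjugation
import Literature.MathematicalPhysics.QuantumLattice.GrassmannLaplacian
import Literature.MathematicalPhysics.QuantumLattice.GrassmannWardIdentity
import Literature.MathematicalPhysics.QuantumLattice.GrassmannGaussianQuadraticInsertion
import Literature.MathematicalPhysics.QuantumFieldTheory.Dimock2011to13.QED3FermionNorm
import HarnessLib

/-!
# Dimock, *Correlation functions for the Gross–Neveu model*, §3.1 PROPOSITION 1 (34) with (40)–(41): the field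
# derivative `∂F/∂ψ` loses `(h − h′)⁻¹` in norm — `‖∂F/∂ψ‖_{h′} ≤ (h − h′)⁻¹‖F‖_h` for `h′ < h` — PROVED (finite generator sets)

statement-level skeleton of published theorems with citation tags; proofs where landed; nothing here is a claim about the Yang–Mills mass gap

**Citation header (reproduction of PUBLISHED work).** J. Dimock, *Correlation functions for the Gross–Neveu model*,
Rev. Math. Phys. **37** (2025) 2450060 (= arXiv:2406.16799v2) [Dimock2025GNCorrelations], §3.1 «Derivatives»,
p.7 L60 – p.9 L65 of the held text layer `paper:arxiv-2406.16799` (`p.NN Lnn` = PDF page ∕ text-layer line). Writer seat p11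
(literature-prover-lit-balaban-p11-g16-0), YM LIT SWEEP item (c) D11; companion of `WeightFunctionGamma.lean` (D11 App. A,
seat p11 gen 15) and of the Gross–Neveu norm files `FieldTranslationNorm.lean` ∕ `FieldVariationNorm.lean`.

**The printed text.** p.2 L31–38: *"A norm with positive parameters `h, h̄` is defined by `‖F‖_{h,h̄} = Σ_{n,m}
(hⁿh̄ᵐ/(n!m!)) ‖F_{nm}‖_{C′}` (2) … We usually have `h = h̄` in which case the norm is denoted `‖F‖_h`."* p.8 L1–21:
the derivative `∂F/∂ψ(x)` removes one field from each monomial (32)–(33), *"The precise meaning is that for `f ∈ C^k(T)`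
`∫ f(x) ∂F/∂ψ(x) dx = Σ_{n,m} (1/(n!m!)) Σ_{j=1}^n (−1)^{j+1} ∫ F_{nm}(x₁,…,x_n,y₁,…,y_m)|_{x_j=x} ψ(x₁)⋯f(x)⋯ψ(x_n)
ψ̄(y₁)⋯ψ̄(y_m) dxdy` (33) where the `f(x)` appears in the `j`th entry. The norm of the derivative is defined as the supremum
over `‖f‖_{C^k} ≤ 1` of the norm of this expression."* **PROPOSITION 1** (p.8 L22–28): *"If `F ∈ G_h` then `∂F/∂ψ` and
`∂F/∂ψ̄` define `G_{h′}` valued distributions for any `h′ < h` and `‖∂F/∂ψ‖_{h′} ≤ (1/(h−h′))‖F‖_h`,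
`‖∂F/∂ψ̄‖_{h′} ≤ (1/(h−h′))‖F‖_h` (34)."* Proof (p.8 L29 – p.9 L13): *"… In `F_n` move the `x` to the left at a cost
`(−1)^{j+1}` and then relabel … Then `‖∂F/∂ψ‖_{h′} ≤ Σ_{n≥1} (h′^{n−1}/(n−1)!) ‖F_n‖_{C′} = (d/dh′)‖F‖_{h′}` (40). But since
`F ∈ G_h` the function `h′ → ‖F‖_{h′}` extends to a complex analytic function for `|h′| < h`. Then by a Cauchy inequality
`(d/dh′)‖F‖_{h′} ≤ (1/(h−h′))‖F‖_h` (41) which gives the result in this case."*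

**What is here (finite generator sets; everything PROVED, no named facts).** The Grassmann algebra on a finite linearly
ordered set of generators `ι` (all the letters `ψ(x), ψ̄(y)`; one weight `h = h̄`) with the monomial-basis norm
`‖F‖_h = Σ_S h^{#S}|c_S(F)|` of `QED3FermionNorm.lean` (= (2) at `h = h̄`, cf. that file's (299)), and the field derivative
`∂/∂ψ(X) = QuantumLattice.grassmannDeriv` (the tree's left derivative, `∂_X(ψ(Y)a) = δ_{XY}a − ψ(Y)∂_Xa`):
* `grassmannDeriv_grassmannBasis` — `∂_X θ_S = (−1)^{#{y∈S | y<X}} θ_{S∖X}` (`X ∈ S`), `0` otherwise: *"move the `x` to the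
  left at a cost `(−1)^{j+1}`"*; `coeff_grassmannDeriv`, `hNorm_grassmannDeriv`;
* `hNormDeriv h F = Σ_S #S h^{#S−1}|c_S(F)|` with **`hasDerivAt_hNorm`** (it IS `(d/dh)‖F‖_h`) and
  **`sum_hNorm_grassmannDeriv` — (40)** in the sharp form `Σ_X ‖∂F/∂ψ(X)‖_{h′} = (d/dh′)‖F‖_{h′}`;
* **`hNormDeriv_le` — (41)**: `(d/dh′)‖F‖_{h′} ≤ (h−h′)⁻¹‖F‖_h` for `0 ≤ h′ < h` — here by the elementary
  `n h′^{n−1}(h − h′) ≤ hⁿ − h′ⁿ ≤ hⁿ` (the print's *"Cauchy inequality"* for the polynomial `h′ ↦ ‖F‖_{h′}`);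
* **`prop1` — PROPOSITION 1 (34)** for the derivative smeared with a test function `f` over any set `V` of generators (e.g.
  the `ψ`-letters, or the `ψ̄`-letters): `‖Σ_{X∈V} f(X) ∂F/∂ψ(X)‖_{h′} ≤ (sup_V |f|)·(h−h′)⁻¹‖F‖_h`, and the single-letter
  form `hNorm_grassmannDeriv_le`.
* v1.1 — **PROPOSITION 2 (43)–(46)**: `prop2_mul_of_even` ∕ `prop2_mul_of_odd` ((43), the tree's graded Leibniz rule
  `grassmannDeriv_mul` on even ∕ odd factors), `prop2_pow_succ` ((44), the tree's `leibniz_pow_succ_of_mem_evenOdd_zero`),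
  `prop2_aeval` ((45) for polynomials `p(A)`, `A` even), `prop2_pow_succ_bound` (the first inequality of (46)).
Not here: the `C^k`-duality of the continuum kernels (the smearing is the finite sum); (45) for genuine power series
(TODO note at `prop2_aeval`); PROPOSITIONS 3–7 (PROP. 3 (57)–(58) is in substance the tree's
`GrassmannGaussianQuadraticInsertion` ∕ `GrassmannGaussianMeasureChange`).
-/

noncomputable section

open Finset

namespace Literature.MathematicalPhysics.QuantumFieldTheory.DimockYuan2024

namespace FieldDerivativeNorm

open Literature.MathematicalPhysics.QuantumLattice
open Literature.MathematicalPhysics.QuantumLattice.GrassmannAlgebra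
open Literature.MathematicalPhysics.QuantumFieldTheory.Dimock2011to13.QED3TorusI

variable {𝕜 : Type*} [RCLike 𝕜] {ι : Type*} [LinearOrder ι] [Fintype ι]

/-! ## `∂/∂ψ(X)` on monomials and on coefficients -/

/-- The number of letters of `S` standing to the left of `X`: the cost `(−1)^{#{y ∈ S | y < X}}` of *"moving the `x` to the
left"*. [cite: Dimock2025GNCorrelations, §3.1 (36)–(37) p.8 L38–45] -/
def delSign (S : Finset ι) (X : ι) : ℕ := (S.filter (· < X)).card

omit [Fintype ι] in
/-- **`∂_X θ_S = (−1)^{#{y∈S | y<X}} θ_{S∖X}`** for `X ∈ S`, and `∂_X θ_S = 0` for `X ∉ S`.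
[cite: Dimock2025GNCorrelations, §3.1 (33), (36)–(37) p.8 L5–45] -/
theorem grassmannDeriv_grassmannBasis [Fintype ι] (X : ι) (S : Finset ι) :
    grassmannDeriv 𝕜 X (grassmannBasis 𝕜 ι S) =
      if X ∈ S then ((-1 : 𝕜) ^ delSign S X) • grassmannBasis 𝕜 ι (S.erase X) else 0 := by
  classical
  induction S using Finset.induction_on_min with
  | empty => rw [grassmannBasis_empty, grassmannDeriv_one, if_neg (Finset.notMem_empty X)]
  | insert a s hmin ih =>
    have has : a ∉ s := fun h => lt_irrefl a (hmin a h)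
    rw [grassmannBasis_insert_of_forall_lt 𝕜 hmin, grassmannDeriv_gen_mul, ih]
    by_cases hXa : X = a
    · subst hXa
      rw [if_pos rfl, if_neg has, mul_zero, sub_zero, if_pos (Finset.mem_insert_self X s), Finset.erase_insert has]
      have h0 : delSign (insert X s) X = 0 := by
        rw [delSign, Finset.card_eq_zero, Finset.filter_eq_empty_iff]
        intro y hy hlt
        rcases Finset.mem_insert.1 hy with rfl | hy
        · exact lt_irrefl _ hlt
        · exact lt_asymm hlt (hmin y hy)
      rw [h0, pow_zero, one_smul]
    · rw [if_neg hXa, zero_sub]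
      by_cases hXs : X ∈ s
      · rw [if_pos hXs, if_pos (Finset.mem_insert_of_mem hXs), mul_smul_comm, ← neg_smul,
          Finset.erase_insert_of_ne (Ne.symm hXa), ← grassmannBasis_insert_of_forall_lt 𝕜 (fun y hy => hmin y (Finset.mem_of_mem_erase hy))]
        congr 1
        have hlt : a < X := hmin X hXs
        have h1 : delSign (insert a s) X = delSign s X + 1 := by
          rw [delSign, delSign, Finset.filter_insert, if_pos hlt, Finset.card_insert_of_notMem]
          exact fun h => has (Finset.mem_of_mem_filter a h)
        rw [h1, pow_succ, mul_neg_one]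
      · rw [if_neg hXs, mul_zero, neg_zero, if_neg]
        exact fun h => (Finset.mem_insert.1 h).elim hXa hXs

/-- **The coefficients of `∂_X F`**: `c_T(∂_X F) = (−1)^{#{y∈T | y<X}} c_{T ∪ {X}}(F)` for `X ∉ T`, `0` for `X ∈ T`.
[cite: Dimock2025GNCorrelations, §3.1 (36)–(37) p.8 L38–45] -/
theorem coeff_grassmannDeriv (X : ι) (F : GrassmannAlgebra 𝕜 ι) (T : Finset ι) :
    coeff (grassmannDeriv 𝕜 X F) T =
      if X ∈ T then 0 else (-1 : 𝕜) ^ delSign (insert X T) X * coeff F (insert X T) := by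
  classical
  have hF : F = ∑ S, coeff F S • grassmannBasis 𝕜 ι S := ((grassmannBasis 𝕜 ι).sum_repr F).symm
  have hterm : ∀ S : Finset ι, coeff (grassmannDeriv 𝕜 X (coeff F S • grassmannBasis 𝕜 ι S)) T =
      if S = insert X T ∧ X ∉ T then (-1 : 𝕜) ^ delSign (insert X T) X * coeff F (insert X T) else 0 := by
    intro S
    rw [map_smul, grassmannDeriv_grassmannBasis]
    by_cases hXS : X ∈ S
    · rw [if_pos hXS, smul_smul, coeff, map_smul, Module.Basis.repr_self, Finsupp.smul_apply, Finsupp.single_apply,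
        smul_eq_mul]
      by_cases hST : S.erase X = T
      · have hS : S = insert X T := by rw [← hST, Finset.insert_erase hXS]
        have hXT : X ∉ T := by rw [← hST]; exact Finset.notMem_erase X S
        rw [if_pos hST, if_pos ⟨hS, hXT⟩, hS, mul_one, mul_comm]
      · rw [if_neg hST, mul_zero, if_neg]
        rintro ⟨rfl, hXT⟩
        exact hST (Finset.erase_insert hXT)
    · rw [if_neg hXS, smul_zero, coeff, map_zero, Finsupp.zero_apply, if_neg]
      rintro ⟨rfl, -⟩
      exact hXS (Finset.mem_insert_self X T)
  have hsum : coeff (grassmannDeriv 𝕜 X F) T = ∑ S, coeff (grassmannDeriv 𝕜 X (coeff F S • grassmannBasis 𝕜 ι S)) T := by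
    conv_lhs => rw [hF, map_sum]
    rw [coeff, map_sum, Finsupp.finsetSum_apply]
  rw [hsum, Finset.sum_congr rfl fun S _ => hterm S]
  by_cases hXT : X ∈ T
  · rw [if_pos hXT]
    exact Finset.sum_eq_zero fun S _ => if_neg fun h => h.2 hXT
  · rw [if_neg hXT]
    simp only [hXT, not_false_eq_true, and_true, Finset.sum_ite_eq', Finset.mem_univ, if_true]

/-- **`‖∂_X F‖_h = Σ_{T ∌ X} h^{#T} |c_{T∪{X}}(F)|`.** [cite: Dimock2025GNCorrelations, §3.1 (37)–(40) p.8 L38 – p.9 L5] -/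
theorem hNorm_grassmannDeriv (h : ℝ) (X : ι) (F : GrassmannAlgebra 𝕜 ι) :
    hNorm h (grassmannDeriv 𝕜 X F) =
      ∑ T ∈ Finset.univ.filter (fun T : Finset ι => X ∉ T), h ^ T.card * ‖coeff F (insert X T)‖ := by
  classical
  unfold hNorm
  rw [Finset.sum_filter]
  refine Finset.sum_congr rfl fun T _ => ?_
  rw [coeff_grassmannDeriv]
  split_ifs with hXT
  · rw [norm_zero, mul_zero]
  · rw [norm_mul, norm_pow, norm_neg, norm_one, one_pow, one_mul]

/-! ## (40): `Σ_X ‖∂_X F‖_h = (d/dh)‖F‖_h` -/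

/-- **`(d/dh)‖F‖_h = Σ_S #S h^{#S−1} |c_S(F)|`** — the derivative of the polynomial `h ↦ ‖F‖_h` (see `hasDerivAt_hNorm`);
the printed `Σ_{n≥1} (h′^{n−1}/(n−1)!) ‖F_n‖_{C′}` of (40). [cite: Dimock2025GNCorrelations, §3.1 (40) p.9 L1–5] -/
def hNormDeriv (h : ℝ) (F : GrassmannAlgebra 𝕜 ι) : ℝ :=
  ∑ S : Finset ι, (S.card : ℝ) * h ^ (S.card - 1) * ‖coeff F S‖

/-- `hNormDeriv h F` is the derivative of `h ↦ ‖F‖_h`. [cite: Dimock2025GNCorrelations, §3.1 (40) p.9 L1–5] -/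
theorem hasDerivAt_hNorm (F : GrassmannAlgebra 𝕜 ι) (h : ℝ) :
    HasDerivAt (fun t : ℝ => hNorm t F) (hNormDeriv h F) h := by
  unfold hNorm hNormDeriv
  refine HasDerivAt.fun_sum fun S _ => ?_
  exact (hasDerivAt_pow S.card h).mul_const _

/-- `(d/dh)‖F‖_h ≥ 0` for `h ≥ 0`. [cite: Dimock2025GNCorrelations, §3.1 (40) p.9 L1–5] -/
theorem hNormDeriv_nonneg {h : ℝ} (hh : 0 ≤ h) (F : GrassmannAlgebra 𝕜 ι) : 0 ≤ hNormDeriv h F :=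
  Finset.sum_nonneg fun _ _ => mul_nonneg (mul_nonneg (Nat.cast_nonneg _) (pow_nonneg hh _)) (norm_nonneg _)

/-- **(40), sharp form on finite generator sets**: `Σ_X ‖∂F/∂ψ(X)‖_h = (d/dh)‖F‖_h` (each monomial `θ_S` is reached from
exactly its `#S` letters). [cite: Dimock2025GNCorrelations, §3.1 (40) p.9 L1–5] -/
theorem sum_hNorm_grassmannDeriv (h : ℝ) (F : GrassmannAlgebra 𝕜 ι) :
    ∑ X, hNorm h (grassmannDeriv 𝕜 X F) = hNormDeriv h F := by
  classical
  simp only [hNorm_grassmannDeriv, Finset.sum_filter]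
  -- reindex the inner sum of each `X` by `S = insert X T`
  have hre : ∀ X : ι, (∑ T : Finset ι, if X ∉ T then h ^ T.card * ‖coeff F (insert X T)‖ else 0) =
      ∑ S : Finset ι, if X ∈ S then h ^ (S.card - 1) * ‖coeff F S‖ else 0 := by
    intro X
    rw [← Finset.sum_filter, ← Finset.sum_filter]
    refine Finset.sum_nbij' (fun T => insert X T) (fun S => S.erase X) ?_ ?_ ?_ ?_ ?_
    · intro T _
      simp only [Finset.mem_filter, Finset.mem_univ, true_and, Finset.mem_insert_self]
    · intro S _
      simp only [Finset.mem_filter, Finset.mem_univ, true_and, Finset.notMem_erase, not_false_eq_true]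
    · intro T hT
      exact Finset.erase_insert (Finset.mem_filter.1 hT).2
    · intro S hS
      exact Finset.insert_erase (Finset.mem_filter.1 hS).2
    · intro T hT
      rw [Finset.card_insert_of_notMem (Finset.mem_filter.1 hT).2, Nat.add_sub_cancel]
  simp only [hre]
  rw [Finset.sum_comm]
  unfold hNormDeriv
  refine Finset.sum_congr rfl fun S _ => ?_
  rw [← Finset.sum_filter, Finset.sum_const, nsmul_eq_mul, mul_assoc]
  congr 1
  rw [Finset.filter_mem_eq_inter, Finset.univ_inter]

/-! ## (41): the "Cauchy inequality" `(d/dh′)‖F‖_{h′} ≤ (h−h′)⁻¹‖F‖_h` -/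

/-- `n h′^{n−1} (h − h′) ≤ hⁿ` for `0 ≤ h′ ≤ h` (from `hⁿ − h′ⁿ = (h−h′)Σ_{i<n} hⁱh′^{n−1−i} ≥ (h−h′)·n h′^{n−1}`).
[folklore] -/
private theorem mul_pow_pred_mul_sub_le {h h' : ℝ} (hh' : 0 ≤ h') (hle : h' ≤ h) (n : ℕ) :
    (n : ℝ) * h' ^ (n - 1) * (h - h') ≤ h ^ n := by
  have hgeom : (∑ i ∈ range n, h ^ i * h' ^ (n - 1 - i)) * (h - h') = h ^ n - h' ^ n := geom_sum₂_mul h h' n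
  have h1 : ∑ i ∈ range n, h' ^ i * h' ^ (n - 1 - i) = (n : ℝ) * h' ^ (n - 1) := by
    rw [Finset.sum_congr rfl fun i hi => by
      rw [← pow_add, Nat.add_sub_cancel' (Nat.le_sub_one_of_lt (Finset.mem_range.1 hi))],
      Finset.sum_const, Finset.card_range, nsmul_eq_mul]
  have hsum : (n : ℝ) * h' ^ (n - 1) ≤ ∑ i ∈ range n, h ^ i * h' ^ (n - 1 - i) := by
    rw [← h1]
    exact Finset.sum_le_sum fun i _ =>
      mul_le_mul_of_nonneg_right (pow_le_pow_left₀ hh' hle i) (pow_nonneg hh' _)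
  have hh : 0 ≤ h - h' := sub_nonneg.2 hle
  calc (n : ℝ) * h' ^ (n - 1) * (h - h') ≤ (∑ i ∈ range n, h ^ i * h' ^ (n - 1 - i)) * (h - h') :=
        mul_le_mul_of_nonneg_right hsum hh
    _ = h ^ n - h' ^ n := hgeom
    _ ≤ h ^ n := sub_le_self _ (pow_nonneg hh' _)

/-- **(41)**: `(d/dh′)‖F‖_{h′} ≤ (h − h′)⁻¹ ‖F‖_h` for `0 ≤ h′ < h` (print: *"by a Cauchy inequality"* for the analytic
function `h′ ↦ ‖F‖_{h′}`; here termwise for the polynomial). [cite: Dimock2025GNCorrelations, §3.1 (41) p.9 L6–13] -/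
theorem hNormDeriv_le {h h' : ℝ} (hh' : 0 ≤ h') (hlt : h' < h) (F : GrassmannAlgebra 𝕜 ι) :
    hNormDeriv h' F ≤ (h - h')⁻¹ * hNorm h F := by
  have hpos : 0 < h - h' := sub_pos.2 hlt
  unfold hNormDeriv hNorm
  rw [Finset.mul_sum]
  refine Finset.sum_le_sum fun S _ => ?_
  rw [← mul_assoc]
  refine mul_le_mul_of_nonneg_right ?_ (norm_nonneg _)
  rw [le_inv_mul_iff₀ hpos, mul_comm]
  exact mul_pow_pred_mul_sub_le hh' hlt.le S.card

/-- `‖∂F/∂ψ(X)‖_{h′} ≤ (h−h′)⁻¹‖F‖_h` for a single letter `X`. [cite: Dimock2025GNCorrelations, §3.1 Prop. 1 (34) p.8 L22–28] -/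
theorem hNorm_grassmannDeriv_le {h h' : ℝ} (hh' : 0 ≤ h') (hlt : h' < h) (X : ι) (F : GrassmannAlgebra 𝕜 ι) :
    hNorm h' (grassmannDeriv 𝕜 X F) ≤ (h - h')⁻¹ * hNorm h F := by
  classical
  refine le_trans ?_ ((sum_hNorm_grassmannDeriv h' F).le.trans (hNormDeriv_le hh' hlt F))
  exact Finset.single_le_sum (f := fun Y => hNorm h' (grassmannDeriv 𝕜 Y F)) (fun Y _ => hNorm_nonneg hh' _)
    (Finset.mem_univ X)

/-- **PROPOSITION 1 (34)**: the field derivative smeared with a test function `f` over a set `V` of letters (the `ψ(x)`, or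
the `ψ̄(y)`) — `∫ f(x) ∂F/∂ψ(x) dx` of (33) — satisfies `‖Σ_{X∈V} f(X) ∂F/∂ψ(X)‖_{h′} ≤ (sup_V|f|) (h−h′)⁻¹ ‖F‖_h` for
`0 ≤ h′ < h`: *"the norm of the derivative is defined as the supremum over `‖f‖ ≤ 1` of the norm of this expression"*, so
`‖∂F/∂ψ‖_{h′} ≤ (h−h′)⁻¹‖F‖_h`. [cite: Dimock2025GNCorrelations, §3.1 Prop. 1 (34) p.8 L19–28] -/
theorem prop1 {h h' : ℝ} (hh' : 0 ≤ h') (hlt : h' < h) (V : Finset ι) (f : ι → 𝕜) {M : ℝ} (hM : 0 ≤ M)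
    (hf : ∀ X ∈ V, ‖f X‖ ≤ M) (F : GrassmannAlgebra 𝕜 ι) :
    hNorm h' (∑ X ∈ V, f X • grassmannDeriv 𝕜 X F) ≤ M * ((h - h')⁻¹ * hNorm h F) := by
  classical
  calc hNorm h' (∑ X ∈ V, f X • grassmannDeriv 𝕜 X F)
      ≤ ∑ X ∈ V, hNorm h' (f X • grassmannDeriv 𝕜 X F) := hNorm_sum_le hh' V _
    _ = ∑ X ∈ V, ‖f X‖ * hNorm h' (grassmannDeriv 𝕜 X F) :=
        Finset.sum_congr rfl fun X _ => hNorm_smul h' (f X) _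
    _ ≤ ∑ X ∈ V, M * hNorm h' (grassmannDeriv 𝕜 X F) :=
        Finset.sum_le_sum fun X hX => mul_le_mul_of_nonneg_right (hf X hX) (hNorm_nonneg hh' _)
    _ = M * ∑ X ∈ V, hNorm h' (grassmannDeriv 𝕜 X F) := (Finset.mul_sum _ _ _).symm
    _ ≤ M * ∑ X, hNorm h' (grassmannDeriv 𝕜 X F) :=
        mul_le_mul_of_nonneg_left (Finset.sum_le_univ_sum_of_nonneg fun X => hNorm_nonneg hh' _) hM
    _ ≤ M * ((h - h')⁻¹ * hNorm h F) :=
        mul_le_mul_of_nonneg_left ((sum_hNorm_grassmannDeriv h' F).le.trans (hNormDeriv_le hh' hlt F)) hM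

/-! ## PROPOSITION 2 (43)–(46): Leibniz, power and chain rules (v1.1)

p.9 L23–65: *"we define `F ∈ G_h` to be even/odd if it has an even/odd number of fields … PROPOSITION 2. 1. If `F, H ∈ G_h`
and `F` is even/odd then `∂/∂ψ(x) FH = (∂F/∂ψ(x))H ± F(∂H/∂ψ(x))` (43). 2. If `F ∈ G_h` is even `∂Fⁿ/∂ψ(x) =
nF^{n−1} ∂F/∂ψ(x)` (44). 3. Suppose `h′ < h` … Let `F = Σ_{n=0}^∞ aₙAⁿ` be an absolutely convergent power series in an
even element of `A ∈ G_h`. Then `∂F/∂ψ(x)` in `G_{h′}` is `∂F/∂ψ(x) = Σ_{n=1}^∞ aₙnA^{n−1} ∂A/∂ψ(x)` (45). Proof. The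
first follows from the definition of the derivative. The second follows by induction on `n` … The series (45) converges
in `G_{h′}` since by Proposition 1 `‖aₙnA^{n−1}∂A/∂ψ‖_{h′} ≤ (h−h′)⁻¹|aₙ| n‖A‖_{h′}^{n−1}‖A‖_h = …` (46)"*. Here: (43) is
the tree's graded Leibniz rule `grassmannDeriv_mul` (`involute` = the parity automorphism) read on even ∕ odd `F`; (44) is
the tree's `leibniz_pow_succ_of_mem_evenOdd_zero`; (45) for POLYNOMIALS `p(A)` (on a finite generator set every element is
algebraic, and the exponential case `∂_X e^{g} = e^{g}∂_X g` is the tree's `grassmannDeriv_grassmannExp_of_mem_evenOdd_zero`);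
(46) its first inequality, smeared as in `prop1`. -/

omit [LinearOrder ι] [Fintype ι] in
/-- **PROPOSITION 2.1 (43), even factor**: `∂_X(FH) = (∂_X F)H + F(∂_X H)`.
[cite: Dimock2025GNCorrelations, §3.1 Prop. 2 (43) p.9 L25–36] -/
theorem prop2_mul_of_even (X : ι) {F : GrassmannAlgebra 𝕜 ι} (hF : F ∈ evenOdd 𝕜 0) (H : GrassmannAlgebra 𝕜 ι) :
    grassmannDeriv 𝕜 X (F * H) = grassmannDeriv 𝕜 X F * H + F * grassmannDeriv 𝕜 X H :=
  grassmannDeriv_mul_of_involute_eq 𝕜 X (CliffordAlgebra.involute_eq_of_mem_even hF) H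

omit [LinearOrder ι] [Fintype ι] in
/-- **PROPOSITION 2.1 (43), odd factor**: `∂_X(FH) = (∂_X F)H − F(∂_X H)`.
[cite: Dimock2025GNCorrelations, §3.1 Prop. 2 (43) p.9 L25–36] -/
theorem prop2_mul_of_odd (X : ι) {F : GrassmannAlgebra 𝕜 ι} (hF : F ∈ evenOdd 𝕜 1) (H : GrassmannAlgebra 𝕜 ι) :
    grassmannDeriv 𝕜 X (F * H) = grassmannDeriv 𝕜 X F * H - F * grassmannDeriv 𝕜 X H := by
  rw [grassmannDeriv_mul, CliffordAlgebra.involute_eq_of_mem_odd hF, neg_mul, sub_eq_add_neg]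

omit [LinearOrder ι] [Fintype ι] in
/-- **PROPOSITION 2.2 (44)**: `∂_X(F^{n+1}) = (n+1) Fⁿ ∂_X F` for `F` even.
[cite: Dimock2025GNCorrelations, §3.1 Prop. 2 (44) p.9 L37–40] -/
theorem prop2_pow_succ (X : ι) {F : GrassmannAlgebra 𝕜 ι} (hF : F ∈ evenOdd 𝕜 0) (n : ℕ) :
    grassmannDeriv 𝕜 X (F ^ (n + 1)) = ((n + 1 : ℕ) : 𝕜) • (F ^ n * grassmannDeriv 𝕜 X F) :=
  leibniz_pow_succ_of_mem_evenOdd_zero 𝕜 (grassmannDeriv 𝕜 X) hF (fun H => prop2_mul_of_even X hF H) n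

omit [LinearOrder ι] [Fintype ι] in
/-- **PROPOSITION 2.3 (45), polynomial case**: `∂_X p(A) = p′(A) · ∂_X A` for `A` even and `p ∈ 𝕜[t]`.
[cite: Dimock2025GNCorrelations, §3.1 Prop. 2 (45) p.9 L41–49] -/
theorem prop2_aeval (X : ι) {A : GrassmannAlgebra 𝕜 ι} (hA : A ∈ evenOdd 𝕜 0) (p : Polynomial 𝕜) :
    grassmannDeriv 𝕜 X (Polynomial.aeval A p) =
      Polynomial.aeval A (Polynomial.derivative p) * grassmannDeriv 𝕜 X A := by
  induction p using Polynomial.induction_on' with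
  | add p q hp hq => rw [map_add, map_add, hp, hq, map_add, map_add, add_mul]
  | monomial n a =>
    rw [Polynomial.derivative_monomial, Polynomial.aeval_monomial, Polynomial.aeval_monomial, ← Algebra.smul_def,
      ← Algebra.smul_def, map_smul, smul_mul_assoc]
    cases n with
    | zero => rw [pow_zero, grassmannDeriv_one, smul_zero, Nat.cast_zero, mul_zero, zero_smul]
    | succ k =>
      rw [prop2_pow_succ X hA k, smul_smul, Nat.add_sub_cancel]
-- TODO(general form): (45) for an absolutely convergent power series `Σ aₙAⁿ` in `G_h`, with convergence in `G_{h′}`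
-- by (46) — needs the `G_h`-topology on the (here finite-dimensional) algebra; exponential case: tree
-- `grassmannDeriv_grassmannExp_of_mem_evenOdd_zero`.

/-- **(46), first inequality** (smeared over a set `V` of letters as in `prop1`): for `A` even, `|f| ≤ M` on `V` and
`0 ≤ h′ < h`, `‖Σ_{X∈V} f(X) (n+1)Aⁿ ∂_X A‖_{h′} ≤ M (n+1) ‖A‖_{h′}ⁿ (h−h′)⁻¹ ‖A‖_h`.
[cite: Dimock2025GNCorrelations, §3.1 Prop. 2 (46) p.9 L53–65] -/
theorem prop2_pow_succ_bound {h h' : ℝ} (hh' : 0 ≤ h') (hlt : h' < h) (V : Finset ι) (f : ι → 𝕜) {M : ℝ}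
    (hM : 0 ≤ M) (hf : ∀ X ∈ V, ‖f X‖ ≤ M) {A : GrassmannAlgebra 𝕜 ι} (hA : A ∈ evenOdd 𝕜 0) (n : ℕ) :
    hNorm h' (∑ X ∈ V, f X • grassmannDeriv 𝕜 X (A ^ (n + 1))) ≤
      M * ((n + 1 : ℕ) * (hNorm h' A ^ n * ((h - h')⁻¹ * hNorm h A))) := by
  have hrw : ∑ X ∈ V, f X • grassmannDeriv 𝕜 X (A ^ (n + 1)) =
      (((n + 1 : ℕ) : 𝕜) • A ^ n) * ∑ X ∈ V, f X • grassmannDeriv 𝕜 X A := by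
    rw [Finset.mul_sum]
    refine Finset.sum_congr rfl fun X _ => ?_
    rw [prop2_pow_succ X hA n, smul_mul_assoc, mul_smul_comm, smul_comm]
  rw [hrw]
  calc hNorm h' ((((n + 1 : ℕ) : 𝕜) • A ^ n) * ∑ X ∈ V, f X • grassmannDeriv 𝕜 X A)
      ≤ hNorm h' (((n + 1 : ℕ) : 𝕜) • A ^ n) * hNorm h' (∑ X ∈ V, f X • grassmannDeriv 𝕜 X A) :=
        hNorm_mul_le hh' _ _
    _ ≤ ((n + 1 : ℕ) * hNorm h' A ^ n) * (M * ((h - h')⁻¹ * hNorm h A)) := by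
        refine mul_le_mul ?_ (prop1 hh' hlt V f hM hf A) (hNorm_nonneg hh' _)
          (mul_nonneg (Nat.cast_nonneg _) (pow_nonneg (hNorm_nonneg hh' _) _))
        rw [hNorm_smul, RCLike.norm_natCast]
        exact mul_le_mul_of_nonneg_left (hNorm_pow_le hh' A n) (Nat.cast_nonneg _)
    _ = M * ((n + 1 : ℕ) * (hNorm h' A ^ n * ((h - h')⁻¹ * hNorm h A))) := by ring

end FieldDerivativeNorm

end Literature.MathematicalPhysics.QuantumFieldTheory.DimockYuan2024
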